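import Summits.NavierStokesRegularity.FluidComputer.ForcedClassicalContinuation
import Summits.NavierStokesRegularity.FluidComputer.PalasekTowerRegisterGlobalEnvelopeAtGeneric
import Literature.Analysis.FluidPDE.TaoH1LocalExistenceForcedHolds
import HarnessLib

/-!
# REGISTER v2.3′: the stub `LocalContinuationAt k` HOLDS at every level — item 19249 reads
# `HeredityAtOne ↔ AprioriCeilingAt 1 ∧ ReadoutFloorsAt 1`, and K2G is «no overshoot ∧ floors» at
# every level, UNCONDITIONALLY

Cell `ns-blowup`, seat `ns-blowup-ecbridge-7` (g3; literature-prover; D-0074 GROUP C «BRIDGE SUPPORT»;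
bears_on LADDER-NS N1, route `PalasekTowerBreakdown`, child crux item stmt-NavierStokesRegularity-19249
`HeredityAtOne` — supported, NOT closed or claimed). LABEL: E–C typing. WHAT THIS IS NOT: not
Navier–Stokes evidence — the forced local well-posedness theorem of the tree fed into this seat's
three-stub cut of the upper half (p425552); no stage, flow or tower is constructed or asserted, and the
two physics stubs `AprioriCeilingAt k` (no overshoot) / `ReadoutFloorsAt k` (the floors) stay OPEN and
appear only inside equivalences.

The three-stub cut of this lineage (`PalasekTowerRegisterGlobalEnvelopeAt.lean`, p425552:
`HeredityAt k ↔ LocalContinuationAt k ∧ AprioriCeilingAt k ∧ ReadoutFloorsAt k` for `k ≥ 1`) had ONE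
analytic (non-physics) conjunct, `LocalContinuationAt k` — every registered stage crosses the end of
its slab under the design force (at `k ≤ 1`: across the end `τ₁` of the FORCED era). Seat
`ns-blowup-ecbridge-1` (g5, `ForcedClassicalContinuation.lean`, p432584) proved it MODULO Tao's forced
local theory `Literature.Analysis.FluidPDE.tao2011_smooth_local_existence_forced` (Tao 2013, Thm. 5.4
(ii)+(iv) WITH forcing), and that named fact is now the THEOREM
`Literature.Analysis.FluidPDE.tao2011_smooth_local_existence_forced_holds`
(`TaoH1LocalExistenceForcedHolds.lean`: the forced Fourier–Picard engine — existence
`ForcedFourierPicardExists` (ns-blowup-lean2), physical transfer `ForcedFourierForceData/Family`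
(ns-blowup-lit), classical half `ForcedFourierMild{Family,Solution,Classical}` (THIS lineage, g2),
raw-force gauge `ForcedFourierForcePressure{,Data}` (ns-blowup-lit3), assembly
`TaoH1LocalExistenceForcedAssembly` (ns-blowup-lit2)). Hence, with NO hypothesis:

* §1 `LocalContinuationAt k` for every `k` is the tree theorem
  `Theorems.palasekTowerBreakdown_localContinuationAt_holds` (ecbridge-1 g6, p441384) — used below through
  `localContinuationAt_of_forced_local_existence tao2011_smooth_local_existence_forced_holds`, not restated.
* §2 **the upper half IS the no-overshoot bet at every level `k ≥ 1`**:
  `continuationEnvelopeAt_iff_aprioriCeilingAt : ContinuationEnvelopeAt k ↔ AprioriCeilingAt k` (at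
  `k ≥ 2` already unconditional by `continuationEnvelopeAt_iff_aprioriCeilingAt_of_two_le`, p431629; new
  at `k = 1`): the registered stub `stub_continuation_envelope_one : ContinuationEnvelopeAt 1` of the line
  `Cruxes/HeredityAtOne/Lines/birth.lean` is EQUIVALENT to `AprioriCeilingAt 1` — «no classical
  finite-energy continuation of a registered level-1 stage exceeds `(5/3)·Y₂` before `τ₂`, for as long
  as it exists» — premature blow-up being excluded by theorem.
* §3 **item 19249 in its two physics stubs**:
  `heredityAtOne_iff_aprioriCeilingAt_and_readoutFloorsAt : HeredityAtOne ↔ AprioriCeilingAt 1 ∧ ReadoutFloorsAt 1`;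
  every level `k ≥ 1` alike (`heredityAt_iff_aprioriCeilingAt_and_readoutFloorsAt`).
* §4 the parent: `heredityFrom_iff_forall_apriori_and_floors` (`k₀ ≥ 1`) and
  **`episodeInductionG_iff_forall_apriori_and_floors : EpisodeInductionG ↔ ∀ k ≥ 1, AprioriCeilingAt k ∧ ReadoutFloorsAt k`**
  — K2G of record is EXACTLY «no overshoot ∧ the next floors» at every level; and the split of record
  `episodeInductionG_iff_apriori_floors_one_and_from_two`.

References: T. Tao, Anal. PDE 6 (2013) = arXiv:1108.1165, Thm. 5.4 [cite: Tao2011, Thm. 5.4 (ii)+(iv)];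
J. C. Robinson, J. L. Rodrigo, W. Sadowski, *The Three-Dimensional Navier–Stokes Equations* (CUP 2016),
Thm. 8.17 [cite: RobinsonRodrigoSadowski2016, Thm. 8.17]; S. Palasek, arXiv:2605.13827 §4
[cite: Palasek2026ElementaryModel, §4].
-/

noncomputable section

namespace Summit.NavierStokesRegularity.FluidComputer.PalasekTowerClayBridge

open Set MeasureTheory Filter Topology Function Real
open scoped ENNReal ContDiff NNReal
open Literature.Analysis.FluidPDE
open Summit.NavierStokesRegularity.NavierStokesRegularity

/-! ## §1 The analytic stub of the upper half holds at every level

`LocalContinuationAt k` holds for EVERY `k`, unconditionally — this is the tree theorem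
`Summit.NavierStokesRegularity.NavierStokesRegularity.Theorems.palasekTowerBreakdown_localContinuationAt_holds`
(seat ns-blowup-ecbridge-1 g6, p441384: Tao's forced local theory fed to the restart loop
`localContinuationAt_of_forced_local_existence`); it is not restated here (its module imports the route
file), the proofs below call `localContinuationAt_of_forced_local_existence
tao2011_smooth_local_existence_forced_holds` directly. -/

/-! ## §2 The upper half is the no-overshoot bet, at every level `k ≥ 1` -/

/-- **`ContinuationEnvelopeAt k ↔ AprioriCeilingAt k` for every `k ≥ 1`, no hypothesis** — the upper
half of the hand-over `k → k+1` (continuation to `τ (k+1)` inside the ceiling) IS the a-priori ceiling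
(no finite-energy classical continuation exceeds `c₂ Y_{k+1}` before `τ (k+1)` while it exists):
premature blow-up without overshoot is impossible (`continuationEnvelopeAt_of_local_apriori`, the
continuation principle) and the local continuation exists (§1). New at `k = 1` (the one-way form at `k = 1` is ecbridge-1 g6's
`Theorems.palasekTowerBreakdown_continuationEnvelopeAt_one_of_apriori`).
[cite: RobinsonRodrigoSadowski2016, Thm. 8.17] -/
theorem continuationEnvelopeAt_iff_aprioriCeilingAt {k : ℕ} (hk : 1 ≤ k) :
    ContinuationEnvelopeAt k ↔ AprioriCeilingAt k :=
  ⟨fun h => h.aprioriCeilingAt,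
    fun h => continuationEnvelopeAt_of_local_apriori hk
      (localContinuationAt_of_forced_local_existence tao2011_smooth_local_existence_forced_holds k) h⟩

/-- The registered upper stub of item 19249 (`stub_continuation_envelope_one : ContinuationEnvelopeAt 1`,
`Cruxes/HeredityAtOne/Lines/birth.lean`) is EQUIVALENT to the no-overshoot bet `AprioriCeilingAt 1`.
[cite: RobinsonRodrigoSadowski2016, Thm. 8.17] -/
theorem continuationEnvelopeAt_one_iff_aprioriCeilingAt_one :
    ContinuationEnvelopeAt 1 ↔ AprioriCeilingAt 1 :=
  continuationEnvelopeAt_iff_aprioriCeilingAt le_rfl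

/-! ## §3 Item 19249 — and every level `k ≥ 1` — in TWO physics stubs -/

/-- **Heredity at level `k ≥ 1` ⇔ no overshoot ∧ the next floors**, no hypothesis:
`HeredityAt k ↔ AprioriCeilingAt k ∧ ReadoutFloorsAt k`. [cite: Palasek2026ElementaryModel, §4] -/
theorem heredityAt_iff_aprioriCeilingAt_and_readoutFloorsAt {k : ℕ} (hk : 1 ≤ k) :
    HeredityAt k ↔ AprioriCeilingAt k ∧ ReadoutFloorsAt k := by
  rw [heredityAt_iff_envelopeAt_and_floorsAt, continuationEnvelopeAt_iff_aprioriCeilingAt hk]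

/-- **ITEM 19249 IN TWO PHYSICS STUBS, no hypothesis**:
`HeredityAtOne ↔ AprioriCeilingAt 1 ∧ ReadoutFloorsAt 1` — the hand-over `1 → 2` holds iff (i) no
finite-energy classical continuation of a registered level-1 stage exceeds `(5/3)·Y₂` before `τ₂` while
it exists, and (ii) every such continuation to `τ₂` inside the ceiling shows the three level-2 floors at
`τ₂` in the ball. The forced-era crossing and «no premature blow-up» are theorems.
[cite: Palasek2026ElementaryModel, §4] -/
theorem heredityAtOne_iff_aprioriCeilingAt_and_readoutFloorsAt :
    HeredityAtOne ↔ AprioriCeilingAt 1 ∧ ReadoutFloorsAt 1 :=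
  heredityAt_iff_aprioriCeilingAt_and_readoutFloorsAt le_rfl

/-- Item 19249 from its two physics stubs. [cite: Palasek2026ElementaryModel, §4] -/
theorem heredityAtOne_of_aprioriCeilingAt_readoutFloorsAt (hA : AprioriCeilingAt 1)
    (hR : ReadoutFloorsAt 1) : HeredityAtOne :=
  heredityAtOne_iff_aprioriCeilingAt_and_readoutFloorsAt.2 ⟨hA, hR⟩

/-- Item 19249 gives the no-overshoot bet at the first rung. [cite: Palasek2026ElementaryModel, §4] -/
theorem HeredityAtOne.aprioriCeilingAt_one (h : HeredityAtOne) : AprioriCeilingAt 1 :=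
  (heredityAtOne_iff_aprioriCeilingAt_and_readoutFloorsAt.1 h).1

/-! ## §4 The parent statements -/

/-- **Heredity from `k₀ ≥ 1` ⇔ the two physics stubs at every level `k ≥ k₀`**, no hypothesis.
[cite: Palasek2026ElementaryModel, §4] -/
theorem heredityFrom_iff_forall_apriori_and_floors {k₀ : ℕ} (hk₀ : 1 ≤ k₀) :
    HeredityFrom k₀ ↔ ∀ k : ℕ, k₀ ≤ k → AprioriCeilingAt k ∧ ReadoutFloorsAt k := by
  rw [heredityFrom_iff_forall_envelopeAt_and_floorsAt]
  refine forall_congr' fun k => forall_congr' fun hk => ?_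
  rw [continuationEnvelopeAt_iff_aprioriCeilingAt (hk₀.trans hk)]

/-- **K2G ⇔ «no overshoot ∧ the next floors» at every level `k ≥ 1`**, no hypothesis:
`EpisodeInductionG ↔ ∀ k ≥ 1, AprioriCeilingAt k ∧ ReadoutFloorsAt k`. The crux `EpisodeInduction`
of the route (= `EpisodeInductionG`) is exactly the conjunction over the levels of the a-priori ceiling
and the readout floors; existence / continuation questions are settled by theorem.
[cite: Palasek2026ElementaryModel, §4] -/
theorem episodeInductionG_iff_forall_apriori_and_floors :
    EpisodeInductionG ↔ ∀ k : ℕ, 1 ≤ k → AprioriCeilingAt k ∧ ReadoutFloorsAt k := by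
  rw [episodeInductionG_iff_heredityFrom_one, heredityFrom_iff_forall_apriori_and_floors le_rfl]

/-- K2G in the split of record (children 19249 / 19250), each child in its two physics stubs:
`EpisodeInductionG ↔ (AprioriCeilingAt 1 ∧ ReadoutFloorsAt 1) ∧ ∀ k ≥ 2, AprioriCeilingAt k ∧ ReadoutFloorsAt k`.
[cite: Palasek2026ElementaryModel, §4] -/
theorem episodeInductionG_iff_apriori_floors_one_and_from_two :
    EpisodeInductionG ↔
      (AprioriCeilingAt 1 ∧ ReadoutFloorsAt 1) ∧
        ∀ k : ℕ, 2 ≤ k → AprioriCeilingAt k ∧ ReadoutFloorsAt k := by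
  rw [episodeInductionG_iff_heredityAtOne_and_heredityFrom_two,
    heredityAtOne_iff_aprioriCeilingAt_and_readoutFloorsAt,
    heredityFrom_iff_forall_apriori_and_floors (by norm_num : 1 ≤ 2)]

/-- K2G from the two physics stubs at every level. [cite: Palasek2026ElementaryModel, §4] -/
theorem episodeInductionG_of_forall_apriori_and_floors
    (h : ∀ k : ℕ, 1 ≤ k → AprioriCeilingAt k ∧ ReadoutFloorsAt k) : EpisodeInductionG :=
  episodeInductionG_iff_forall_apriori_and_floors.2 h

end Summit.NavierStokesRegularity.FluidComputer.PalasekTowerClayBridge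

end
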